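import Literature.MathematicalPhysics.QuantumFieldTheory.Balaban1983to89.Node00.Record12LiveSelector
import Literature.MathematicalPhysics.QuantumFieldTheory.Balaban1983to89.Node00.Record12ResidualsBg

/-!
# NODE 00 · K0′ ROW P11 (`Provisos₁₂.bg`, the background proviso of [III] p. 259) — ITS REDUCTION TO PRINT'S SENTENCE at the Stage-12 record: level 0 is
# VACUOUS, the unit branch of def-R's background map is a theorem, and what remains is ONE displayed hypothesis «on the SOLVABLE retained configurations the
# (2.12) minimiser lies in the spaces of record» = [Balaban1988Convergent] (2.7) p. 255 + p. 259 with [15] Thm 1 ([Balaban1985Variational]) and the regular-space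
# lemma of [Balaban1985RegularSpaces]

statement-level bookkeeping over published theorems with citation tags; kernel-checked compositions of tree theorems;
nothing here is a claim about the Yang–Mills mass gap.

Cell `pub-ymgap` (HUMAN RULING D-0062, Track A), seat `pub-ymgap-dag-n11-e` generation 4, on dag-lead WORDS-117 ASK (A2) ∕ DEDUP-233 GO (3a) (pub-ymgap INBOX, 2026-08-27):
«pen the level-0 lemma + the honest REDUCTION of row P11 into print's sentence with the exact locator for the analysis pen» — filed `--supports` the route's K0′
`Record12Inhabited` (stmt-QuantumFields-19902) AS A HELPER (count-neutral).  The gate row: `pub-ymgap-dag-lead/RECORD13-CLOSABILITY-GATE.md` § P11; plan skeleton v4-LIVE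
`stub_bgRowLive` = the `bg` field VERBATIM at the live witness.  This seat's census (INBOX «DAGN11E-G4-ANSWER-A2(-ADDENDUM)», HOME `P11-CENSUS.md`) is the text of the
docstrings below.

WHAT ROW P11 SAYS (`Node00.BgProviso`, def-T's `Stage12Params.Provisos₁₂.bg`): along every run whose history stays in the window up to length `n ≤ K`, for every
sequence `s`, every RETAINED configuration `W ∈ suppOfRecord₁₂ θ p n s` (def-R's regular support `regSuppOfRecord … cR`), every scale `1 ≤ j ≤ n` and every domain `X`,
the background of record `UbgOfRecord₁₂ θ p n s W` read in `Φ` lies in `U^c_j(X, α_{0,j}, α_{1,j})` AND in `Ũ^c_j(X)` of record.  THE OBJECTS: `UbgOfRecord₁₂ θ p 0 = (W ↦ W 0)`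
and — the point — AT LEVEL 0 THE PROVISO QUANTIFIES OVER `1 ≤ j ≤ 0`: VACUOUS (§1); `UbgOfRecord₁₂ θ p (n+1) = UbgMSOfRecord …` = def-R's TOTALISED solution map of
(2.12): the CHOSEN MINIMISER of the Wilson action in print's class `regMSOfRecord` under the averaging constraints on `𝔅({Ω_j(s)})` when `W` is SOLVABLE (a minimiser
exists), the UNIT configuration otherwise (`UminOfRecord_of_not`) — and the unit configuration lies in both spaces of record under the residual laws and positive
radii (def-T's `Sect2.one_mem_spaceI` ∕ `one_mem_spaceMS`) (§2).  So the row's CONTENT is exactly §2's displayed hypothesis `Stage12Params.MinimiserInSpaces θ`: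
«for solvable retained `W`, the minimiser lies in the spaces» — in print: (2.7) «the inductive assumptions imply U_k ∈ U^c_j(X, α_{0,j}, α_{1,j}) for proper
restrictions on ε_j» (p. 259), whose proof is [15] Thm 1 (the constrained minimiser of a regular `W` exists and is regular, with plaquette variables controlled by
those of `W`) + the regular-space ∕ gauge-fixing lemma of [Balaban1985RegularSpaces] (small plaquette variables ⇒ a small axial-gauge potential with derivative
bounds: r11's conditions (i)–(ii) of `B12RegularSpaces111.Satisfies`) + the NUMERICS inequality between the small-field letters of the support (`cR, A₀, p₀`) and
the radii letters (`C₀, q₀, C₁, q₁`) — NOT the class bound `εreg·η_j²` of `regMSOfRecord` (at the numerics of record `εreg = 1` exceeds `α₀(g) = g·(log g⁻²)²` for small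
`g`).  Condition (iv) of r11's spaces reads the RESIDUAL background functions `Rz.bgI j Y`; at the residuals of record (`RzOfRecord = Sect2.Residual.unit`) it holds
trivially.  NONE of this follows from the route's (B)-endpoint or from N11's §2 form (`HasSect2FormAEZ`): `BgProviso` is an INPUT under which the term bounds are read.

BY NAME and UNCHANGED (imported, never restated): node00-def-T's `Node00.Record12` (`BgProviso`, `bgProviso_zero`, `UbgOfRecord₁₂(_succ)`, `suppOfRecord₁₂`, `settingOfRecord₁₂(_pos)`,
`alphaPos₁₂_of_inInterval`, `Sect2.one_mem_spaceI`), def-R's `UbgMSOfRecord_apply` ∕ `UminOfRecord_of_not` ∕ `IsMinimizer` ∕ `regMSOfRecord`, node00-def-K0a's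
`Node00.Record12LiveSelector` (`Stage12Params.liveRepin`, `theta12LiveOfRecord`, `admissible_theta12LiveOfRecord`), and node00-def-K0b's `Node00.Record12ResidualsBg` (p484642:
the PULL-BACKS `Sect2.ofBackgroundC_mem_spaceI_iff` ∕ `…MS_iff` and the UNIT-RECIPE membership lemmas `Sect2.Residual.ofBackgroundC_mem_spaceI_unit_of_condI` ∕
`…MS_unit_of_conds` — cited, not re-derived; §5 is the junction K0b's HANDOFF (t2″) asks for).

CONTENTS (0 `sorry`, 1 `def` (a displayed `Prop`), standard axioms).
§1 `Stage12Params.bg_zero` (row P11 at level 0, every `θ`, no hypothesis — def-T's `bgProviso_zero` by name).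
§2 `Stage12Params.MinimiserInSpaces θ` (THE displayed hypothesis — print's sentence at def-R's objects, per windowed run, level `n+1 ≤ K`, solvable retained `W`, scale,
   domain) · `UbgOfRecord₁₂_succ_eq_one_of_not_solvable` (unit branch of the background map) · `Stage12Params.bg_succ_of_minimiserInSpaces` ·
   ★ `Stage12Params.bg_of_minimiserInSpaces` (ROW P11 IN FULL ⟸ `MinimiserInSpaces θ` + the residual laws `∀ K, (θ.Rz K).Laws` + admissibility — NOTHING ELSE: the
   unit branch's radii are read only up to the scale, hence inside the window, by §1b's `unitPair_mem_space234_of_le` ∕ `Sect2.one_mem_spaceMS_of_le` — def-T's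
   `one_mem_spaceMS` asked them at every level, an artefact this file removes).
§1b r11's spaces, ANY residual with its laws: `unitPair_mem_space234_of_le` (r11's unit lemma with radii only at `1 ≤ n ≤ j`), `Sect2.one_mem_spaceMS_of_le`.
§3 AT A LIVE RE-PIN AND AT THE LIVE WITNESS: `Stage12Params.bg_liveRepin_of_minimiserInSpaces` (the selector is not read by the row: K0c's `rfl` transports are not even
   needed — the theorem is θ-generic) · `bgRow_theta12LiveOfRecord_of_minimiserInSpaces` (plan's `BgRowLive` body at `theta12LiveOfRecord F N ζ Rz Zt` ⟸
   `MinimiserInSpaces θ₀ˡⁱᵛᵉ` + `(∀ K, (Rz K).Laws)`; admissibility discharged by K0a's `admissible_theta12LiveOfRecord`).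
§4 IN r11's CONDITION VOCABULARY, ANY RESIDUAL (dag-lead WORDS-118 «(3a) v2»): `Stage12Params.minimiserInSpaces_of_satisfies` (the displayed hypothesis ⟸ r11's `Satisfies` ∧
   `Satisfies234` of the minimiser's pair at every windowed run ∕ level ∕ SOLVABLE retained `W` ∕ scale ∕ domain, through K0b's pull-backs) · ★ `Stage12Params.bg_of_satisfies`.
§5 ★ THE JUNCTION WITH K0b AT THE RESIDUALS OF RECORD (`θ.HasResidualsOfRecord`: `θ.Rz = RzOfRecord = Residual.unit`, so (iv)∕(2.35)∕(2.37) drop out):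
   `Stage12Params.HasResidualsOfRecord.minimiserInSpaces_of_conds` (the displayed hypothesis ⟸ K0b's THREE small-field conditions (hI) [I] (1.11)–(1.12), (h234) [III] (2.34),
   (h238) [III] (2.38) on `ι ∘ UbgOfRecord₁₂ θ p (n+1) s W`, asked ONLY AT SOLVABLE retained `W` and levels `≥ 1` — K0b's `…_unit_of_condI` ∕ `…_unit_of_conds` per scale) ·
   ★★ `Stage12Params.HasResidualsOfRecord.bg_of_conds_solvable` (ROW P11 VERBATIM from those: K0b's `bg_of_conds` with its hypotheses RESTRICTED to the solvable retained
   configurations of positive level — the unit branch and level 0 discharged here) · `bgRow_theta12LiveOfRecord_of_conds` (plan's `BgRowLive` body at θ₀ˡⁱᵛᵉ with K0b's residuals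
   of record, from the three conditions at the solvable minimisers).

HONEST FRAMING.  Count-neutral kernel bookkeeping: a case split (level 0 ∕ unit branch ∕ minimiser branch) on def-R's totalised background map and def-T's non-vacuity
lemmas; the minimiser branch is NOT proved — it is print's (2.7) + [15] Thm 1 + [Balaban1985RegularSpaces], DISPLAYED as `MinimiserInSpaces θ` with locators, for the
analysis pen dag-lead's OPS-NOTE-16 asks the director to mint (`pub-ymgap-node00-def-P11`).  K0′ is NOT closed by this file; row P11 stays ◐ until that pen lands the
hypothesis.  One finite four-torus programme at fixed `ε`; nothing continuum ∕ ℝ⁴ ∕ OS ∕ mass gap ∕ Clay.  No `sorry`, no `instance`, no `notation`.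
Sources: T. Bałaban, CMP **119** (1988) 243–285 [III] (2.7) p. 255, (2.10)–(2.13) pp. 256–257, (2.28) p. 259 («proper restrictions on ε_j»), (2.34)–(2.39) p. 261;
CMP **102** (1985) 277–309 [Balaban1985Variational] Thm 1 p. 279; CMP **99** (1985) 75–102 [Balaban1985RegularSpaces] (1.7)–(1.8) p. 77; CMP **109** (1987) 249–301
[Balaban1987RG1] (1.11)–(1.16) p. 262.
-/

noncomputable section

open MeasureTheory
open scoped Matrix.Norms.L2Operator

namespace Literature.MathematicalPhysics.QuantumFieldTheory.Balaban1983to89.Node00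

open T4Continuum B14.Eq218Concrete B15DeterminingSets

variable (F : T4Family) (N : ℕ) [NeZero N]

/-! ## §1  Level 0 of the background proviso is vacuous (def-T's `bgProviso_zero`, by name) -/

section LevelZero

variable {F N} (θ : Stage12Params F N) (p : B12.RunParams)

/-- **ROW P11 AT LEVEL 0, every Stage-12 parameter, no hypothesis**: `BgProviso … 0 …` quantifies the scales `1 ≤ j ≤ 0` — there are none (node00-def-T's
`bgProviso_zero`, cited; the `n = 0` instance of `Provisos₁₂.bg`'s body). [cite: Balaban1988Convergent, (2.28) p.259 (bookkeeping)] -/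
theorem Stage12Params.bg_zero :
    BgProviso F N p.K (settingOfRecord₁₂ F N θ p) (θ.Rz p.K) θ.τ9.M 0 (suppOfRecord₁₂ F N θ p 0) (UbgOfRecord₁₂ F N θ p 0) :=
  bgProviso_zero p.K _ _ _ _ _

end LevelZero

/-! ## §1b  r11's spaces: the unit pair in `Ũ^c_j` from radii AT THE SCALES `1 ≤ n ≤ j` ONLY; membership of a real background from r11's conditions -/

section Spaces234

variable {P : Params} {i : ℕ} {𝔸 : Type*} [NormedRing 𝔸] [NormedAlgebra ℂ 𝔸] [CompleteSpace 𝔸] {𝓜 : B12RegularSpaces111.Model 𝔸}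

open B12RegularSpaces111 B14Radii B14RegularSpaces234 B14RegularSpaces234Inner in
/-- **The unit pair lies in `Ũ^c_j(X, α̃₀, α̃₁)` given positive radii AT THE SCALES `1 ≤ n ≤ j` ONLY** — r11's `B14RegularSpaces234Inner.unitPair_mem_space234`
re-proved with its radii hypotheses restricted to the range the three conditions actually read (every clause of (2.34)–(2.39) is quantified `∀ n, 1 ≤ n → n ≤ j`); so a
consumer needs the radii `α_{0,n}(g_n), α_{1,n}(g_n)` positive only up to the scale, i.e. only INSIDE the window — not at the junk levels beyond the torus.  Proof verbatim
r11's: factorisation `U = 1`, `A′ = 0`, local gauges `u = 1`, `A = 0`, every printed strict bound with left side `0`. [cite: Balaban1988Convergent, (2.34)-(2.39) p.261] -/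
theorem unitPair_mem_space234_of_le (F : MSFrame P i 𝔸) {c : MSConsts} (h0 : 0 ≤ c.β) (h1 : c.β < 1) (hL : 0 < c.L)
    (hξ : 0 < c.ξ) (hBCM : 0 < c.B * c.C * c.M) {α₀ α₁ : ℕ → ℝ} (hα₀ : ∀ n, 1 ≤ n → n ≤ c.j → 0 < α₀ n)
    (hα₁ : ∀ n, 1 ≤ n → n ≤ c.j → 0 < α₁ n) (hUp : ∀ p, F.bg.Up p 1 = 1) (hJp : ∀ p b, F.bg.Jp p 1 b = 0) :
    (B12RegularSpaces111Mono.unitPair : FieldPair P i 𝔸ˣ 𝔸) ∈ space234 𝓜 F c α₀ α₁ := by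
  have h38 : ∀ n, 1 ≤ n → n ≤ c.j → 0 < rad238 c.B c.C c.M (α₀ n) := fun n hn1 hnj => mul_pos hBCM (hα₀ n hn1 hnj)
  have h39 : ∀ n, 1 ≤ n → n ≤ c.j → 0 < rad239 c.β (α₁ n) c.j n := fun n hn1 hnj => mul_pos (shrink_pos h0 h1 _) (hα₁ n hn1 hnj)
  have hplaq : ∀ {k : ℕ} (q : Plaq P k), ‖(↑(plaq (1 : PBond P k → 𝔸ˣ) q) : 𝔸) - 1‖ = 0 := fun q => by
    rw [B12RegularSpaces111Mono.plaq_one, Units.val_one, sub_self, norm_zero]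
  refine ⟨fun _ _ => 𝓜.Gc.one_mem, fun _ _ => 𝓜.gc.zero_mem, 1, fun _ => 0,
    B12RegularSpaces111Mono.factors_one c.toStepConsts, ?_, ?_, ?_⟩
  · refine ⟨fun _ _ => 𝓜.G.one_mem, fun n hn1 hnj q _ => ?_, fun n hn1 hnj q _ => ?_, fun p _ _ n hn1 hnj q _ => ?_,
      fun n hn1 hnj b _ => ?_, fun p _ _ n hn1 hnj b _ => ?_⟩
    · rw [hplaq]; exact rad234_pos h0 h1 (hα₀ n hn1 hnj) hL hξ
    · show ‖(↑(plaq (1 : PBond P i → 𝔸ˣ) q) : 𝔸) - 1‖ < _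
      rw [hplaq]; exact rad234_pos h0 h1 (hα₀ n hn1 hnj) hL hξ
    · show ‖(↑(plaq (F.bg.Up p 1) q) : 𝔸) - 1‖ < _
      rw [hUp, hplaq]; exact rad235_pos h0 h1 (hα₀ n hn1 hnj) hL
    · show ‖(0 : 𝔸)‖ < _
      rw [norm_zero]; exact rad236_pos h0 h1 (hα₀ n hn1 hnj) hL hξ
    · show ‖F.bg.Jp p 1 b‖ < _
      rw [hJp, norm_zero]; exact rad237_pos h0 h1 (hα₀ n hn1 hnj) hL
  · refine ⟨fun n hn1 hnj C _ => ⟨1, fun _ => 𝓜.G.one_mem, fun _ => 0, fun b _ => ?_, fun b _ => ?_, fun q _ => ?_⟩⟩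
    · rw [B12RegularSpaces111Mono.expI_zero]
      show (1 : Site P i → 𝔸ˣ) b.src * (1 : PBond P i → 𝔸ˣ) b * ((1 : Site P i → 𝔸ˣ) b.tgt)⁻¹ = 1
      simp
    · rw [norm_zero, mul_zero]; exact h38 n hn1 hnj
    · simp only [grad, sub_self, smul_zero, norm_zero, mul_zero]; exact h38 n hn1 hnj
  · refine ⟨fun _ _ => 𝓜.gc.zero_mem, fun n hn1 hnj b _ => ?_, fun n hn1 hnj q _ => ?_⟩
    · rw [norm_zero, mul_zero]; exact h39 n hn1 hnj
    · simp only [nabla, mul_zero, zero_mul, sub_self, smul_zero, norm_zero, mul_zero]; exact h39 n hn1 hnj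

end Spaces234

namespace Sect2

section Membership

variable {P : Params} {𝔸 : Type*} [NormedRing 𝔸] [NormedAlgebra ℂ 𝔸] [CompleteSpace 𝔸] {G : Type*} [GaugeGroup G]

/-- **THE UNIT BACKGROUND LIES IN `Ũ^c_j(X)` OF RECORD GIVEN POSITIVE RADII AT THE SCALES `1 ≤ n ≤ j` ONLY** (def-T's `Sect2.one_mem_spaceMS` asks them at every
level; r11's conditions read them only up to `j` — `unitPair_mem_space234_of_le`): the unit branch of row P11 costs radii INSIDE THE WINDOW only.
[cite: Balaban1988Convergent, (2.34)–(2.39) p.261] -/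
theorem one_mem_spaceMS_of_le (S : Setting 𝔸 G) (hS : S.Pos) {Rz : Residual P 𝔸} (hRz : Rz.Laws) (M j : ℕ) (Y : Set (Site P 0)) (Ω : ℕ → Set (Site P 0))
    (hα : ∀ n, 1 ≤ n → n ≤ j → 0 < S.lf.alpha0 (S.flow.g n) ∧ 0 < S.lf.alpha1 (S.flow.g n)) :
    ofBackgroundC S.ι (1 : GaugeField P 0 G) ∈ spaceMS S Rz M j Y Ω := by
  rw [ofBackgroundC_one]
  exact ⟨_, unitPair_mem_space234_of_le (frameMS Rz M j Y Ω) hS.βc_nonneg hS.βc_lt_one (Nat.cast_pos.mpr P.L_pos)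
    (pow_pos (inv_pos.mpr (Nat.cast_pos.mpr P.L_pos)) j)
    hS.BCM_pos (fun n h1 hj => (hα n h1 hj).1) (fun n h1 hj => (hα n h1 hj).2) (hRz.bgMS_Up_one j Y) (hRz.bgMS_Jp_one j Y), rfl⟩

end Membership

end Sect2

/-! ## §2  Positive levels: the unit branch is a theorem; the minimiser branch is print's sentence, displayed -/

section Positive

variable {F N} (θ : Stage12Params F N)

/-- **THE DISPLAYED HYPOTHESIS OF ROW P11 — print's sentence at def-R's objects**: along every run whose history stays in the window `]0, θ.γ]` up to the length
`n + 1 ≤ K`, for every sequence `s` and every retained configuration `W ∈ suppOfRecord₁₂ θ p (n+1) s` for which the variational problem (2.12) (class `regMSOfRecord`,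
constraints on `𝔅({Ω_j(s)})`) IS SOLVABLE, the background of record `UbgOfRecord₁₂ θ p (n+1) s W` — then the chosen minimiser — read in `Φ` lies in `U^c_j(X, α_{0,j},
α_{1,j})` and in `Ũ^c_j(X)` of record at every scale `1 ≤ j ≤ n+1` and every domain `X`.  In print: (2.7) + «proper restrictions on ε_j» (p. 259), PROVED by [15] Thm 1
(existence + regularity of the constrained minimiser) and the regular-space ∕ gauge-fixing lemma of [Balaban1985RegularSpaces]; here DISPLAYED, never asserted — the
content the P11 analysis pen owes (with the numerics inequality between the support's small-field letters and the radii letters).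
[cite: Balaban1988Convergent, (2.7) p.255, (2.12)–(2.13) pp.256–257, (2.28) p.259; Balaban1985Variational, Thm 1 p.279; Balaban1985RegularSpaces, (1.7)–(1.8) p.77] -/
def Stage12Params.MinimiserInSpaces : Prop :=
  ∀ (p : B12.RunParams) (n : ℕ), n + 1 ≤ p.K → Step.InInterval θ.γ (n + 1) (gOfRecord₁₀ F N θ.toStage9Params p) →
    ∀ (s : SeqOfRecord F θ.ν θ.τ9.M (gOfRecord₁₀ F N θ.toStage9Params p) p.K (n + 1)) (W : B15DeterminingSets.MSField (F.P p.K) (SU N)),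
      W ∈ suppOfRecord₁₂ F N θ p (n + 1) s →
      (∃ U₀, IsMinimizer (avOfRecord F N p.K) (regMSOfRecord F N θ.ν p.K (n + 1) s.Ω) (genSet s.Ω (n + 1)) W U₀) →
      ∀ j, 1 ≤ j → j ≤ n + 1 → ∀ X : (Sect2.domSys (F.P p.K) θ.τ9.M j).Dom,
        Sect2.ofBackgroundC (settingOfRecord₁₂ F N θ p).ι (UbgOfRecord₁₂ F N θ p (n + 1) s W) ∈
            Sect2.spaceI (settingOfRecord₁₂ F N θ p) (θ.Rz p.K) θ.τ9.M j (Sect2.domSites (F.P p.K) θ.τ9.M j X)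
              ((settingOfRecord₁₂ F N θ p).lf.alpha0 ((settingOfRecord₁₂ F N θ p).flow.g j))
              ((settingOfRecord₁₂ F N θ p).lf.alpha1 ((settingOfRecord₁₂ F N θ p).flow.g j)) ∧
          Sect2.ofBackgroundC (settingOfRecord₁₂ F N θ p).ι (UbgOfRecord₁₂ F N θ p (n + 1) s W) ∈
            Sect2.spaceMS (settingOfRecord₁₂ F N θ p) (θ.Rz p.K) θ.τ9.M j (Sect2.domSites (F.P p.K) θ.τ9.M j X) s.Ω

/-- **THE UNIT BRANCH OF THE BACKGROUND MAP OF RECORD**: at a positive level, on a configuration `W` for which (2.12) is NOT solvable in print's class, def-R's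
totalised background of record is the UNIT configuration (`UminOfRecord_of_not`, FILE 1's documented junk default). [cite: Balaban1988Convergent, (2.12)–(2.13) pp.256–257 (typing convention)] -/
theorem UbgOfRecord₁₂_succ_eq_one_of_not_solvable (p : B12.RunParams) (n : ℕ)
    (s : SeqOfRecord F θ.ν θ.τ9.M (gOfRecord₁₀ F N θ.toStage9Params p) p.K (n + 1)) (W : B15DeterminingSets.MSField (F.P p.K) (SU N))
    (hW : ¬ ∃ U₀, IsMinimizer (avOfRecord F N p.K) (regMSOfRecord F N θ.ν p.K (n + 1) s.Ω) (genSet s.Ω (n + 1)) W U₀) :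
    UbgOfRecord₁₂ F N θ p (n + 1) s W = 1 := by
  rw [UbgOfRecord₁₂_succ, UbgMSOfRecord_apply, UminOfRecord_of_not _ _ hW]
  rfl

/-- **ROW P11 AT A POSITIVE LEVEL `n + 1 ≤ K` FROM PRINT'S SENTENCE** (+ the residual laws and admissibility; nothing else): on a solvable retained `W` the displayed
hypothesis; on an unsolvable one the background is the unit configuration, which lies in `U^c_j` of record (def-T's `Sect2.one_mem_spaceI`) and in `Ũ^c_j` of record
(`Sect2.one_mem_spaceMS_of_le`) — the radii `α_{0,m}(g_m), α_{1,m}(g_m)`, `m ≤ j ≤ n+1`, being positive INSIDE THE WINDOW (`alphaPos₁₂_of_inInterval`).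
[cite: Balaban1988Convergent, (2.7) p.255, (2.28) p.259, (2.34)–(2.39) p.261; Balaban1987RG1, (1.11)–(1.16) p.262] -/
theorem Stage12Params.bg_succ_of_minimiserInSpaces (hθ : θ.Admissible F N) (hrz : ∀ K, (θ.Rz K).Laws)
    (hM : θ.MinimiserInSpaces) (p : B12.RunParams) (n : ℕ) (hn : n + 1 ≤ p.K)
    (hw : Step.InInterval θ.γ (n + 1) (gOfRecord₁₀ F N θ.toStage9Params p)) :
    BgProviso F N p.K (settingOfRecord₁₂ F N θ p) (θ.Rz p.K) θ.τ9.M (n + 1) (suppOfRecord₁₂ F N θ p (n + 1)) (UbgOfRecord₁₂ F N θ p (n + 1)) := by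
  intro s W hW j h1 hj X
  by_cases hsol : ∃ U₀, IsMinimizer (avOfRecord F N p.K) (regMSOfRecord F N θ.ν p.K (n + 1) s.Ω) (genSet s.Ω (n + 1)) W U₀
  · exact hM p n hn hw s W hW hsol j h1 hj X
  · rw [UbgOfRecord₁₂_succ_eq_one_of_not_solvable θ p n s W hsol]
    exact ⟨Sect2.one_mem_spaceI (settingOfRecord₁₂ F N θ p) hθ.pos.1 (hrz p.K) θ.τ9.M j _ (alphaPos₁₂_of_inInterval hθ hw hj).1
        (alphaPos₁₂_of_inInterval hθ hw hj).2,
      Sect2.one_mem_spaceMS_of_le (settingOfRecord₁₂ F N θ p) (settingOfRecord₁₂_pos F N θ hθ.pos p) (hrz p.K) θ.τ9.M j _ s.Ω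
        fun m _ hm => alphaPos₁₂_of_inInterval hθ hw (hm.trans hj)⟩

/-- **★ ROW P11 IN FULL — def-T's `Provisos₁₂.bg` body at `θ` — FROM PRINT'S SENTENCE `MinimiserInSpaces θ`** (+ the residual laws and admissibility, nothing else):
level 0 vacuous (§1), positive levels by `bg_succ_of_minimiserInSpaces`.  This is the reduction of the K0′ row to ONE displayed hypothesis with its locator;
nothing of Bałaban asserted. [cite: Balaban1988Convergent, (2.7) p.255, (2.28) p.259; Balaban1985Variational, Thm 1 p.279; Balaban1985RegularSpaces, (1.7)–(1.8) p.77] -/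
theorem Stage12Params.bg_of_minimiserInSpaces (hθ : θ.Admissible F N) (hrz : ∀ K, (θ.Rz K).Laws) (hM : θ.MinimiserInSpaces) :
    ∀ (p : B12.RunParams) (n : ℕ), n ≤ p.K → Step.InInterval θ.γ n (gOfRecord₁₀ F N θ.toStage9Params p) →
      BgProviso F N p.K (settingOfRecord₁₂ F N θ p) (θ.Rz p.K) θ.τ9.M n (suppOfRecord₁₂ F N θ p n) (UbgOfRecord₁₂ F N θ p n) := by
  intro p n hn hw
  cases n with
  | zero => exact Stage12Params.bg_zero θ p
  | succ n => exact Stage12Params.bg_succ_of_minimiserInSpaces θ hθ hrz hM p n hn hw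

end Positive

/-! ## §3  At a live re-pin and at the live witness `θ₀ˡⁱᵛᵉ` (the row does not read the selector) -/

section Live

variable {F N} (θ : Stage12Params F N)

/-- **ROW P11 AT A LIVE RE-PIN `θ.liveRepin`** — the instance of `bg_of_minimiserInSpaces` at node00-def-K0a's re-pinned parameter (the background map, the support and
the setting do not read the selector, but no transport is needed: the theorem is θ-generic). [cite: Balaban1988Convergent, (2.28) p.259; Balaban1989LargeFieldI, (0.3) p.176 (bookkeeping)] -/
theorem Stage12Params.bg_liveRepin_of_minimiserInSpaces (hθ : θ.Admissible F N) (hrz : ∀ K, (θ.Rz K).Laws)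
    (hM : (θ.liveRepin F N).MinimiserInSpaces) :
    ∀ (p : B12.RunParams) (n : ℕ), n ≤ p.K → Step.InInterval (θ.liveRepin F N).γ n (gOfRecord₁₀ F N (θ.liveRepin F N).toStage9Params p) →
      BgProviso F N p.K (settingOfRecord₁₂ F N (θ.liveRepin F N) p) ((θ.liveRepin F N).Rz p.K) (θ.liveRepin F N).τ9.M n
        (suppOfRecord₁₂ F N (θ.liveRepin F N) p n) (UbgOfRecord₁₂ F N (θ.liveRepin F N) p n) :=
  Stage12Params.bg_of_minimiserInSpaces (θ.liveRepin F N) hθ.liveRepin hrz hM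

variable (ζ : ZetaOfRecord F N numerics7OfRecord₁₂ 1) (Rz : (K : ℕ) → Sect2.Residual (F.P K) (MatA N)) (Zt : (K : ℕ) → TkResidualW F N (FluctV N) K)

/-- **★ PLAN'S `BgRowLive` BODY AT THE LIVE WITNESS `θ₀ˡⁱᵛᵉ = theta12LiveOfRecord F N ζ Rz Zt`** (skeleton v4-LIVE `stub_bgRowLive`, any residual objects) FROM PRINT'S SENTENCE
`MinimiserInSpaces θ₀ˡⁱᵛᵉ` + the residual laws of `Rz` — admissibility discharged (K0a's `admissible_theta12LiveOfRecord`), radii by the window.  At the residuals of record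
`Rz := RzOfRecord` the laws are K0b's `rzLaws_RzOfRecord`: there P11 ⟺ (essentially) `MinimiserInSpaces θ₀ˡⁱᵛᵉ`. [cite: Balaban1988Convergent, (2.7) p.255, (2.28) p.259; Balaban1985Variational, Thm 1 p.279; Balaban1985RegularSpaces, (1.7)–(1.8) p.77] -/
theorem bgRow_theta12LiveOfRecord_of_minimiserInSpaces (hrz : ∀ K, (Rz K).Laws)
    (hM : (theta12LiveOfRecord F N ζ Rz Zt).MinimiserInSpaces) :
    ∀ (p : B12.RunParams) (n : ℕ), n ≤ p.K →
      Step.InInterval (theta12LiveOfRecord F N ζ Rz Zt).γ n (gOfRecord₁₀ F N (theta12LiveOfRecord F N ζ Rz Zt).toStage9Params p) →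
      BgProviso F N p.K (settingOfRecord₁₂ F N (theta12LiveOfRecord F N ζ Rz Zt) p) ((theta12LiveOfRecord F N ζ Rz Zt).Rz p.K)
        (theta12LiveOfRecord F N ζ Rz Zt).τ9.M n (suppOfRecord₁₂ F N (theta12LiveOfRecord F N ζ Rz Zt) p n)
        (UbgOfRecord₁₂ F N (theta12LiveOfRecord F N ζ Rz Zt) p n) :=
  Stage12Params.bg_of_minimiserInSpaces (theta12LiveOfRecord F N ζ Rz Zt) (admissible_theta12LiveOfRecord F N ζ Rz Zt) hrz hM

end Live

/-! ## §4  The displayed hypothesis IN r11's CONDITION VOCABULARY — what the P11 analysis pen delivers, condition by condition -/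

section Conditions

variable {F N} (θ : Stage12Params F N)

/-- **`MinimiserInSpaces θ` FROM r11's CONDITIONS AT THE MINIMISER** (dag-lead WORDS-118 «(3a) v2»): it suffices that, for every windowed run, level `n+1 ≤ K`, sequence,
SOLVABLE retained `W`, scale `1 ≤ j ≤ n+1` and domain `X`, the pair `(ι∘U, 0)` of the chosen minimiser `U = UbgOfRecord₁₂ θ p (n+1) s W` SATISFIES r11's four conditions
of `U^c_j(X, α_{0,j}, α_{1,j})` (`B12RegularSpaces111.Satisfies` at the frame of record `frameI (θ.Rz K) M j X`: (iii) = the PLAQUETTE BOUND `|∂U − 1| < α_{0,j}(g_j)η_j²` on `X`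
— [15] Thm 1's quantitative regularity + the (2.7) numerics inequality —, (i)–(ii) = the LOCAL GAUGE DATA — [Balaban1985RegularSpaces] —, (iv) = the residual background
functions, free at the unit residual) AND r11's three multi-scale conditions of `Ũ^c_j(X)` (`B14RegularSpaces234.Satisfies234` at `frameMS … s.Ω`: (2.34)–(2.39) layer-wise).
[cite: Balaban1987RG1, (1.11)–(1.16) p.262; Balaban1988Convergent, (2.7) p.255, (2.28) p.259, (2.34)–(2.39) p.261; Balaban1985Variational, Thm 1 p.279; Balaban1985RegularSpaces, (1.7)–(1.8) p.77] -/
theorem Stage12Params.minimiserInSpaces_of_satisfies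
    (h : ∀ (p : B12.RunParams) (n : ℕ), n + 1 ≤ p.K → Step.InInterval θ.γ (n + 1) (gOfRecord₁₀ F N θ.toStage9Params p) →
      ∀ (s : SeqOfRecord F θ.ν θ.τ9.M (gOfRecord₁₀ F N θ.toStage9Params p) p.K (n + 1)) (W : B15DeterminingSets.MSField (F.P p.K) (SU N)),
        W ∈ suppOfRecord₁₂ F N θ p (n + 1) s →
        (∃ U₀, IsMinimizer (avOfRecord F N p.K) (regMSOfRecord F N θ.ν p.K (n + 1) s.Ω) (genSet s.Ω (n + 1)) W U₀) →
        ∀ j, 1 ≤ j → j ≤ n + 1 → ∀ X : (Sect2.domSys (F.P p.K) θ.τ9.M j).Dom,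
          B12RegularSpaces111.Satisfies (settingOfRecord₁₂ F N θ p).𝓜
              (Sect2.frameI (θ.Rz p.K) θ.τ9.M j (Sect2.domSites (F.P p.K) θ.τ9.M j X))
              (B12RegularSpaces111.StepConsts.ofParams (F.P p.K) (settingOfRecord₁₂ F N θ p).cB j)
              ((settingOfRecord₁₂ F N θ p).lf.alpha0 ((settingOfRecord₁₂ F N θ p).flow.g j))
              ((settingOfRecord₁₂ F N θ p).lf.alpha1 ((settingOfRecord₁₂ F N θ p).flow.g j))
              ((settingOfRecord₁₂ F N θ p).lf.alpha0 ((settingOfRecord₁₂ F N θ p).flow.g j))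
              (⟨fun b => (settingOfRecord₁₂ F N θ p).ι (UbgOfRecord₁₂ F N θ p (n + 1) s W b), fun _ => 0⟩ :
                FieldPair (F.P p.K) 0 (MatA N)ˣ (MatA N)) ∧
            B14RegularSpaces234.Satisfies234 (settingOfRecord₁₂ F N θ p).𝓜
              (Sect2.frameMS (θ.Rz p.K) θ.τ9.M j (Sect2.domSites (F.P p.K) θ.τ9.M j X) s.Ω)
              (B14RegularSpaces234.MSConsts.ofParams (F.P p.K) (settingOfRecord₁₂ F N θ p).βc (settingOfRecord₁₂ F N θ p).B
                (settingOfRecord₁₂ F N θ p).C (settingOfRecord₁₂ F N θ p).Mr j)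
              (fun m => (settingOfRecord₁₂ F N θ p).lf.alpha0 ((settingOfRecord₁₂ F N θ p).flow.g m))
              (fun m => (settingOfRecord₁₂ F N θ p).lf.alpha1 ((settingOfRecord₁₂ F N θ p).flow.g m))
              (⟨fun b => (settingOfRecord₁₂ F N θ p).ι (UbgOfRecord₁₂ F N θ p (n + 1) s W b), fun _ => 0⟩ :
                FieldPair (F.P p.K) 0 (MatA N)ˣ (MatA N))) :
    θ.MinimiserInSpaces := by
  intro p n hn hw s W hW hsol j h1 hj X
  obtain ⟨hI, hMS⟩ := h p n hn hw s W hW hsol j h1 hj X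
  exact ⟨(Sect2.ofBackgroundC_mem_spaceI_iff _ _ _ _ _ _ _ _).2 (B12RegularSpaces111.mem_space_of_satisfies hI),
    (Sect2.ofBackgroundC_mem_spaceMS_iff _ _ _ _ _ _ _).2 hMS⟩

/-- **★ ROW P11 FROM r11's CONDITIONS AT THE MINIMISER** (the composition: `minimiserInSpaces_of_satisfies` ∘ `bg_of_minimiserInSpaces`) — the gate row's «what is
missing» in the vocabulary the analysis pen (dag-lead OPS-NOTE-16, director-ym R218 `pub-ymgap-node00-def-P11`) delivers: the PLAQUETTE BOUND (iii)∕(2.34)–(2.37) of the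
constrained minimiser ([15] Thm 1 + (2.7)), the LOCAL GAUGE DATA (i)–(ii)∕(2.38)–(2.39) ([Balaban1985RegularSpaces]), the residual-background clauses (iv) (free at the
unit residual). [cite: Balaban1988Convergent, (2.7) p.255, (2.28) p.259, (2.34)–(2.39) p.261; Balaban1987RG1, (1.11)–(1.16) p.262; Balaban1985Variational, Thm 1 p.279] -/
theorem Stage12Params.bg_of_satisfies (hθ : θ.Admissible F N) (hrz : ∀ K, (θ.Rz K).Laws)
    (h : ∀ (p : B12.RunParams) (n : ℕ), n + 1 ≤ p.K → Step.InInterval θ.γ (n + 1) (gOfRecord₁₀ F N θ.toStage9Params p) →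
      ∀ (s : SeqOfRecord F θ.ν θ.τ9.M (gOfRecord₁₀ F N θ.toStage9Params p) p.K (n + 1)) (W : B15DeterminingSets.MSField (F.P p.K) (SU N)),
        W ∈ suppOfRecord₁₂ F N θ p (n + 1) s →
        (∃ U₀, IsMinimizer (avOfRecord F N p.K) (regMSOfRecord F N θ.ν p.K (n + 1) s.Ω) (genSet s.Ω (n + 1)) W U₀) →
        ∀ j, 1 ≤ j → j ≤ n + 1 → ∀ X : (Sect2.domSys (F.P p.K) θ.τ9.M j).Dom,
          B12RegularSpaces111.Satisfies (settingOfRecord₁₂ F N θ p).𝓜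
              (Sect2.frameI (θ.Rz p.K) θ.τ9.M j (Sect2.domSites (F.P p.K) θ.τ9.M j X))
              (B12RegularSpaces111.StepConsts.ofParams (F.P p.K) (settingOfRecord₁₂ F N θ p).cB j)
              ((settingOfRecord₁₂ F N θ p).lf.alpha0 ((settingOfRecord₁₂ F N θ p).flow.g j))
              ((settingOfRecord₁₂ F N θ p).lf.alpha1 ((settingOfRecord₁₂ F N θ p).flow.g j))
              ((settingOfRecord₁₂ F N θ p).lf.alpha0 ((settingOfRecord₁₂ F N θ p).flow.g j))
              (⟨fun b => (settingOfRecord₁₂ F N θ p).ι (UbgOfRecord₁₂ F N θ p (n + 1) s W b), fun _ => 0⟩ :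
                FieldPair (F.P p.K) 0 (MatA N)ˣ (MatA N)) ∧
            B14RegularSpaces234.Satisfies234 (settingOfRecord₁₂ F N θ p).𝓜
              (Sect2.frameMS (θ.Rz p.K) θ.τ9.M j (Sect2.domSites (F.P p.K) θ.τ9.M j X) s.Ω)
              (B14RegularSpaces234.MSConsts.ofParams (F.P p.K) (settingOfRecord₁₂ F N θ p).βc (settingOfRecord₁₂ F N θ p).B
                (settingOfRecord₁₂ F N θ p).C (settingOfRecord₁₂ F N θ p).Mr j)
              (fun m => (settingOfRecord₁₂ F N θ p).lf.alpha0 ((settingOfRecord₁₂ F N θ p).flow.g m))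
              (fun m => (settingOfRecord₁₂ F N θ p).lf.alpha1 ((settingOfRecord₁₂ F N θ p).flow.g m))
              (⟨fun b => (settingOfRecord₁₂ F N θ p).ι (UbgOfRecord₁₂ F N θ p (n + 1) s W b), fun _ => 0⟩ :
                FieldPair (F.P p.K) 0 (MatA N)ˣ (MatA N))) :
    ∀ (p : B12.RunParams) (n : ℕ), n ≤ p.K → Step.InInterval θ.γ n (gOfRecord₁₀ F N θ.toStage9Params p) →
      BgProviso F N p.K (settingOfRecord₁₂ F N θ p) (θ.Rz p.K) θ.τ9.M n (suppOfRecord₁₂ F N θ p n) (UbgOfRecord₁₂ F N θ p n) :=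
  Stage12Params.bg_of_minimiserInSpaces θ hθ hrz (Stage12Params.minimiserInSpaces_of_satisfies θ h)

end Conditions

/-! ## §5  ★ The junction with node00-def-K0b's `Record12ResidualsBg` at the residuals of record: K0b's three conditions, asked only at the SOLVABLE minimisers -/

section JunctionK0b

variable {F N} {θ : Stage12Params F N}

/-- **THE DISPLAYED HYPOTHESIS OF ROW P11 FROM K0b's THREE SMALL-FIELD CONDITIONS, AT THE RESIDUALS OF RECORD, ASKED ONLY AT THE SOLVABLE MINIMISERS**: at a `θ` with
`θ.HasResidualsOfRecord` (so `θ.Rz K = Residual.unit`: (I.1.16), (2.35), (2.37) are void — K0b §2), `MinimiserInSpaces θ` follows from, for every windowed run, level `n+1 ≤ K`,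
sequence, retained `W` FOR WHICH (2.12) IS SOLVABLE, scale `1 ≤ j ≤ n+1`, domain `X`: (hI) [I]'s condition (i) (1.11)–(1.12) for `ι ∘ U` (`U` the chosen minimiser), (h234)
[III]'s (2.34) plaquette bounds on the layers along `s.Ω`, (h238) [III]'s (2.38) local gauges — K0b's `Sect2.Residual.ofBackgroundC_mem_spaceI_unit_of_condI` ∕
`…_mem_spaceMS_unit_of_conds` per scale (model laws `settingOfRecord₁₂_laws`, signs `Admissible.pos`, radii in the window `alphaPos₁₂_of_inInterval`).
[cite: Balaban1987RG1, (1.11)–(1.16) p.262; Balaban1988Convergent, (2.7) p.255, (2.28) p.259, (2.34)–(2.39) p.261; Balaban1985Variational, Thm 1 p.279] -/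
theorem Stage12Params.HasResidualsOfRecord.minimiserInSpaces_of_conds (hres : θ.HasResidualsOfRecord F N) (hθ : θ.Admissible F N)
    (hI : ∀ (p : B12.RunParams) (n : ℕ), n + 1 ≤ p.K → Step.InInterval θ.γ (n + 1) (gOfRecord₁₀ F N θ.toStage9Params p) →
      ∀ (s : SeqOfRecord F θ.ν θ.τ9.M (gOfRecord₁₀ F N θ.toStage9Params p) p.K (n + 1)) (W : B15DeterminingSets.MSField (F.P p.K) (SU N)),
        W ∈ suppOfRecord₁₂ F N θ p (n + 1) s →
        (∃ U₀, IsMinimizer (avOfRecord F N p.K) (regMSOfRecord F N θ.ν p.K (n + 1) s.Ω) (genSet s.Ω (n + 1)) W U₀) →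
        ∀ j, 1 ≤ j → j ≤ n + 1 → ∀ X : (Sect2.domSys (F.P p.K) θ.τ9.M j).Dom,
          B12RegularSpaces111.CondI (settingOfRecord₁₂ F N θ p).𝓜
            (Sect2.frameI (Sect2.Residual.unit (F.P p.K) (MatA N)) θ.τ9.M j (Sect2.domSites (F.P p.K) θ.τ9.M j X))
            (B12RegularSpaces111.StepConsts.ofParams (F.P p.K) (settingOfRecord₁₂ F N θ p).cB j)
            ((settingOfRecord₁₂ F N θ p).lf.alpha0 ((settingOfRecord₁₂ F N θ p).flow.g j))
            (fun b => (settingOfRecord₁₂ F N θ p).ι (UbgOfRecord₁₂ F N θ p (n + 1) s W b)))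
    (h234 : ∀ (p : B12.RunParams) (n : ℕ), n + 1 ≤ p.K → Step.InInterval θ.γ (n + 1) (gOfRecord₁₀ F N θ.toStage9Params p) →
      ∀ (s : SeqOfRecord F θ.ν θ.τ9.M (gOfRecord₁₀ F N θ.toStage9Params p) p.K (n + 1)) (W : B15DeterminingSets.MSField (F.P p.K) (SU N)),
        W ∈ suppOfRecord₁₂ F N θ p (n + 1) s →
        (∃ U₀, IsMinimizer (avOfRecord F N p.K) (regMSOfRecord F N θ.ν p.K (n + 1) s.Ω) (genSet s.Ω (n + 1)) W U₀) →
        ∀ j, 1 ≤ j → j ≤ n + 1 → ∀ X : (Sect2.domSys (F.P p.K) θ.τ9.M j).Dom, ∀ m, 1 ≤ m → m ≤ j →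
          ∀ q ∈ (Sect2.regionOfSet (F.P p.K) (Sect2.layerSet j (Sect2.domSites (F.P p.K) θ.τ9.M j X) s.Ω m)).plaqs,
            ‖(↑(B12RegularSpaces111.plaq (fun b => (settingOfRecord₁₂ F N θ p).ι (UbgOfRecord₁₂ F N θ p (n + 1) s W b)) q) : MatA N) - 1‖ <
              B14Radii.rad234 (settingOfRecord₁₂ F N θ p).βc ((settingOfRecord₁₂ F N θ p).lf.alpha0 ((settingOfRecord₁₂ F N θ p).flow.g m))
                ((F.P p.K).eta j) (F.P p.K).L j m)
    (h238 : ∀ (p : B12.RunParams) (n : ℕ), n + 1 ≤ p.K → Step.InInterval θ.γ (n + 1) (gOfRecord₁₀ F N θ.toStage9Params p) →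
      ∀ (s : SeqOfRecord F θ.ν θ.τ9.M (gOfRecord₁₀ F N θ.toStage9Params p) p.K (n + 1)) (W : B15DeterminingSets.MSField (F.P p.K) (SU N)),
        W ∈ suppOfRecord₁₂ F N θ p (n + 1) s →
        (∃ U₀, IsMinimizer (avOfRecord F N p.K) (regMSOfRecord F N θ.ν p.K (n + 1) s.Ω) (genSet s.Ω (n + 1)) W U₀) →
        ∀ j, 1 ≤ j → j ≤ n + 1 → ∀ X : (Sect2.domSys (F.P p.K) θ.τ9.M j).Dom,
          B14RegularSpaces234.CondII238 (settingOfRecord₁₂ F N θ p).𝓜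
            (Sect2.frameMS (Sect2.Residual.unit (F.P p.K) (MatA N)) θ.τ9.M j (Sect2.domSites (F.P p.K) θ.τ9.M j X) s.Ω)
            (B14RegularSpaces234.MSConsts.ofParams (F.P p.K) (settingOfRecord₁₂ F N θ p).βc (settingOfRecord₁₂ F N θ p).B
              (settingOfRecord₁₂ F N θ p).C (settingOfRecord₁₂ F N θ p).Mr j)
            (fun m => (settingOfRecord₁₂ F N θ p).lf.alpha0 ((settingOfRecord₁₂ F N θ p).flow.g m))
            (fun b => (settingOfRecord₁₂ F N θ p).ι (UbgOfRecord₁₂ F N θ p (n + 1) s W b))) :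
    θ.MinimiserInSpaces := by
  intro p n hn hw s W hW hsol j h1 hj X
  have hRz : θ.Rz p.K = Sect2.Residual.unit (F.P p.K) (MatA N) := by rw [hres.Rz_eq]; rfl
  rw [hRz]
  exact ⟨Sect2.Residual.ofBackgroundC_mem_spaceI_unit_of_condI (settingOfRecord₁₂ F N θ p) (settingOfRecord₁₂_laws F N θ p) θ.τ9.M j _
      (alphaPos₁₂_of_inInterval hθ hw hj).1 (alphaPos₁₂_of_inInterval hθ hw hj).2 _ (hI p n hn hw s W hW hsol j h1 hj X),
    Sect2.Residual.ofBackgroundC_mem_spaceMS_unit_of_conds (settingOfRecord₁₂ F N θ p) (settingOfRecord₁₂_laws F N θ p)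
      (settingOfRecord₁₂_pos F N θ hθ.pos p) θ.τ9.M j _ s.Ω (fun m _ hmj => (alphaPos₁₂_of_inInterval hθ hw (hmj.trans hj)).1)
      (fun m _ hmj => (alphaPos₁₂_of_inInterval hθ hw (hmj.trans hj)).2) _ (h234 p n hn hw s W hW hsol j h1 hj X) (h238 p n hn hw s W hW hsol j h1 hj X)⟩

/-- **★★ ROW P11 VERBATIM, AT THE RESIDUALS OF RECORD, FROM K0b's THREE CONDITIONS AT THE SOLVABLE MINIMISERS ONLY** — node00-def-K0b's `HasResidualsOfRecord.bg_of_conds` with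
its hypotheses RESTRICTED to the retained configurations of positive level for which (2.12) is solvable (the UNIT branch and LEVEL 0 are discharged in this file):
`θ.HasResidualsOfRecord`, `θ.Admissible`, (hI)∕(h234)∕(h238) at the solvable minimisers ⊢ `Provisos₁₂.bg`'s body.  This is the gate row's «what is missing» in its
sharpest typed form: [15] Thm 1 + (2.7) (plaquette bounds (1.11)∕(2.34) of the CONSTRAINED MINIMISER, with the numerics inequality between the support's small-field letters
and the radii letters) and [Balaban1985RegularSpaces] (local gauges (1.12)∕(2.38)), and nothing else. [cite: Balaban1988Convergent, (2.7) p.255, (2.28) p.259, (2.34)–(2.39) p.261; Balaban1987RG1, (1.11)–(1.16) p.262; Balaban1985Variational, Thm 1 p.279; Balaban1985RegularSpaces, (1.7)–(1.8) p.77] -/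
theorem Stage12Params.HasResidualsOfRecord.bg_of_conds_solvable (hres : θ.HasResidualsOfRecord F N) (hθ : θ.Admissible F N)
    (hI : ∀ (p : B12.RunParams) (n : ℕ), n + 1 ≤ p.K → Step.InInterval θ.γ (n + 1) (gOfRecord₁₀ F N θ.toStage9Params p) →
      ∀ (s : SeqOfRecord F θ.ν θ.τ9.M (gOfRecord₁₀ F N θ.toStage9Params p) p.K (n + 1)) (W : B15DeterminingSets.MSField (F.P p.K) (SU N)),
        W ∈ suppOfRecord₁₂ F N θ p (n + 1) s →
        (∃ U₀, IsMinimizer (avOfRecord F N p.K) (regMSOfRecord F N θ.ν p.K (n + 1) s.Ω) (genSet s.Ω (n + 1)) W U₀) →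
        ∀ j, 1 ≤ j → j ≤ n + 1 → ∀ X : (Sect2.domSys (F.P p.K) θ.τ9.M j).Dom,
          B12RegularSpaces111.CondI (settingOfRecord₁₂ F N θ p).𝓜
            (Sect2.frameI (Sect2.Residual.unit (F.P p.K) (MatA N)) θ.τ9.M j (Sect2.domSites (F.P p.K) θ.τ9.M j X))
            (B12RegularSpaces111.StepConsts.ofParams (F.P p.K) (settingOfRecord₁₂ F N θ p).cB j)
            ((settingOfRecord₁₂ F N θ p).lf.alpha0 ((settingOfRecord₁₂ F N θ p).flow.g j))
            (fun b => (settingOfRecord₁₂ F N θ p).ι (UbgOfRecord₁₂ F N θ p (n + 1) s W b)))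
    (h234 : ∀ (p : B12.RunParams) (n : ℕ), n + 1 ≤ p.K → Step.InInterval θ.γ (n + 1) (gOfRecord₁₀ F N θ.toStage9Params p) →
      ∀ (s : SeqOfRecord F θ.ν θ.τ9.M (gOfRecord₁₀ F N θ.toStage9Params p) p.K (n + 1)) (W : B15DeterminingSets.MSField (F.P p.K) (SU N)),
        W ∈ suppOfRecord₁₂ F N θ p (n + 1) s →
        (∃ U₀, IsMinimizer (avOfRecord F N p.K) (regMSOfRecord F N θ.ν p.K (n + 1) s.Ω) (genSet s.Ω (n + 1)) W U₀) →
        ∀ j, 1 ≤ j → j ≤ n + 1 → ∀ X : (Sect2.domSys (F.P p.K) θ.τ9.M j).Dom, ∀ m, 1 ≤ m → m ≤ j →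
          ∀ q ∈ (Sect2.regionOfSet (F.P p.K) (Sect2.layerSet j (Sect2.domSites (F.P p.K) θ.τ9.M j X) s.Ω m)).plaqs,
            ‖(↑(B12RegularSpaces111.plaq (fun b => (settingOfRecord₁₂ F N θ p).ι (UbgOfRecord₁₂ F N θ p (n + 1) s W b)) q) : MatA N) - 1‖ <
              B14Radii.rad234 (settingOfRecord₁₂ F N θ p).βc ((settingOfRecord₁₂ F N θ p).lf.alpha0 ((settingOfRecord₁₂ F N θ p).flow.g m))
                ((F.P p.K).eta j) (F.P p.K).L j m)
    (h238 : ∀ (p : B12.RunParams) (n : ℕ), n + 1 ≤ p.K → Step.InInterval θ.γ (n + 1) (gOfRecord₁₀ F N θ.toStage9Params p) →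
      ∀ (s : SeqOfRecord F θ.ν θ.τ9.M (gOfRecord₁₀ F N θ.toStage9Params p) p.K (n + 1)) (W : B15DeterminingSets.MSField (F.P p.K) (SU N)),
        W ∈ suppOfRecord₁₂ F N θ p (n + 1) s →
        (∃ U₀, IsMinimizer (avOfRecord F N p.K) (regMSOfRecord F N θ.ν p.K (n + 1) s.Ω) (genSet s.Ω (n + 1)) W U₀) →
        ∀ j, 1 ≤ j → j ≤ n + 1 → ∀ X : (Sect2.domSys (F.P p.K) θ.τ9.M j).Dom,
          B14RegularSpaces234.CondII238 (settingOfRecord₁₂ F N θ p).𝓜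
            (Sect2.frameMS (Sect2.Residual.unit (F.P p.K) (MatA N)) θ.τ9.M j (Sect2.domSites (F.P p.K) θ.τ9.M j X) s.Ω)
            (B14RegularSpaces234.MSConsts.ofParams (F.P p.K) (settingOfRecord₁₂ F N θ p).βc (settingOfRecord₁₂ F N θ p).B
              (settingOfRecord₁₂ F N θ p).C (settingOfRecord₁₂ F N θ p).Mr j)
            (fun m => (settingOfRecord₁₂ F N θ p).lf.alpha0 ((settingOfRecord₁₂ F N θ p).flow.g m))
            (fun b => (settingOfRecord₁₂ F N θ p).ι (UbgOfRecord₁₂ F N θ p (n + 1) s W b))) :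
    ∀ (p : B12.RunParams) (n : ℕ), n ≤ p.K → Step.InInterval θ.γ n (gOfRecord₁₀ F N θ.toStage9Params p) →
      BgProviso F N p.K (settingOfRecord₁₂ F N θ p) (θ.Rz p.K) θ.τ9.M n (suppOfRecord₁₂ F N θ p n) (UbgOfRecord₁₂ F N θ p n) :=
  Stage12Params.bg_of_minimiserInSpaces θ hθ hres.rzLaws (hres.minimiserInSpaces_of_conds hθ hI h234 h238)

end JunctionK0b

end Literature.MathematicalPhysics.QuantumFieldTheory.Balaban1983to89.Node00

end
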